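import Literature.MathematicalPhysics.QuantumFieldTheory.Balaban1983to89.Beta.AveragingThirdJet

/-!
# `BalabanUV.Beta.ReversedChartCalculus` — binder row D1, AVG-LETTERS chain (an3-g33's CUT «AN3-33E» for an1's plan AN1-28B, M3):
# THE REVERSED-ORDER BACKGROUND LETTER `(1 + τ₂ιc)(1 + τ₁ιb)` IN NODE 12's `Tau 𝔸` ∕ `Rho 𝔸` — splitting, inverse, Ad-expansion, chart form

HONEST FRAMING (cell charter, verbatim): «discharging BetaPertH makes Balaban's UV stability UNCONDITIONAL — a real
constructive-QFT result; it is NOT the continuum limit and NOT the Clay problem.»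
HONEST DEPENDENCY: continuum YM on T⁴ ⇐ BetaPertH ∧ nine spine estimates (0/9 proved); BetaPertH ⇐ (D1) ∧ (D4) ∧ CAP+tail;
G-an2-4 gates asym, D1 and NE2/3/4.
DERIVED cell leaf ([folklore] ring algebra in node 12's nested dual numbers, `AveragingThirdJet` §2 only; statements = an3-g33's elaborated
signature list `gen33/CUT-33E-signatures.v1.deeabbe9f9241828.lean`, proofs here).  WHY: under the axis reflection the background chart letter
of node 12's product chart appears at the partner bond in REVERSED order, `E♯_α = (1 + τ₂ιc)(1 + τ₁ιb)` (`b`, `c` the sign-flipped pulled-back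
letters), and the fluctuation letter Ad-rotated by it (an3's `RootedJetReflection.omegaR_self`); M3 needs (β2) the D-splitting
`E♯ = (1 + τ₁ιb)(1 + τ₂ιc)·(1 + τ₁τ₂ι[c,b])`, (β0) its inverse, (β1) the exact Ad-expansion `W ↦ W + τ₁[ιb,W] + τ₂[ιc,W] + τ₁τ₂[ιc,[ιb,W]]`,
(β3) the `Rho`-form (fluctuation moved from the right of the reversed background to the left of the ordered one).  No statement of Bałaban's
papers, no `[cite:]`, no `Prop` fact, no table; 0∕4 binders of the wall touched.  NOT D1, NOT BetaPertH, NOT continuum, NOT Clay.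
Provenance: β sub-cell, D1 formalisation swarm, unit b2b-balaban-beta-d1-formalise-leaf-05 gen 7, 2026-08-20 (v1); no existing file touched.
-/

namespace Summit.QuantumFields.BalabanUV.Beta.ReversedChartCalculus

open Literature.MathematicalPhysics.QuantumFieldTheory.Balaban1983to89.Beta
open Literature.MathematicalPhysics.QuantumFieldTheory.Balaban1983to89.Beta.AveragingThirdJet
open Literature.MathematicalPhysics.QuantumFieldTheory.Balaban1983to89.Beta.AveragingThirdJet.Tau

variable {𝔸 : Type*} [Ring 𝔸]

/-! ## §1 The reversed letter: splitting and inverse -/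

/-- [folklore] (β2) **REVERSED-ORDER SPLITTING** of a two-parameter background letter: `(1 + τ₂ιc)(1 + τ₁ιb) = (1 + τ₁ιb)(1 + τ₂ιc)·(1 + τ₁τ₂ι(cb − bc))`. -/
theorem reversed_split (b c : 𝔸) :
    ((1 + τ₂ * ι c) * (1 + τ₁ * ι b) : Tau 𝔸) = (1 + τ₁ * ι b) * (1 + τ₂ * ι c) * (1 + τ12 * ι (c * b - b * c)) :=
  ext4 (by simp) (by simp) (by simp) (by simp [mul_add, add_mul])

/-- [folklore] (β2′) … the commutator factor may equally stand on the left. -/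
theorem reversed_split' (b c : 𝔸) :
    ((1 + τ₂ * ι c) * (1 + τ₁ * ι b) : Tau 𝔸) = (1 + τ12 * ι (c * b - b * c)) * ((1 + τ₁ * ι b) * (1 + τ₂ * ι c)) :=
  ext4 (by simp) (by simp) (by simp) (by simp [mul_add, add_mul])

/-- [folklore] (β0) The reversed letter times the reversed inverse letter is `1`. -/
theorem reversed_mul_inv (b c : 𝔸) : ((1 + τ₂ * ι c) * (1 + τ₁ * ι b) : Tau 𝔸) * ((1 - τ₁ * ι b) * (1 - τ₂ * ι c)) = 1 :=
  ext4 (by simp) (by simp) (by simp) (by simp [mul_add, add_mul, mul_sub, sub_mul])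

/-- [folklore] (β0) … and in the other order. -/
theorem inv_mul_reversed (b c : 𝔸) : ((1 - τ₁ * ι b) * (1 - τ₂ * ι c) : Tau 𝔸) * ((1 + τ₂ * ι c) * (1 + τ₁ * ι b)) = 1 :=
  ext4 (by simp) (by simp) (by simp) (by simp [mul_add, add_mul, mul_sub, sub_mul])

/-! ## §2 The Ad-expansion of a fluctuation letter under the reversed background letter -/

/-- [folklore] (β1) **Ad-EXPANSION** (exact, `τ₁² = τ₂² = 0`): for ANY `W : Tau 𝔸`,
`(1 + τ₂ιc)(1 + τ₁ιb) · W · (1 − τ₁ιb)(1 − τ₂ιc) = W + τ₁[ιb, W] + τ₂[ιc, W] + τ₁τ₂[ιc, [ιb, W]]`. -/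
theorem conj_reversed_expand (b c : 𝔸) (W : Tau 𝔸) :
    (1 + τ₂ * ι c) * (1 + τ₁ * ι b) * W * ((1 - τ₁ * ι b) * (1 - τ₂ * ι c))
      = W + τ₁ * (ι b * W - W * ι b) + τ₂ * (ι c * W - W * ι c) + τ12 * (ι c * (ι b * W - W * ι b) - (ι b * W - W * ι b) * ι c) := by
  refine ext4 ?_ ?_ ?_ ?_
  · simp [mul_add, add_mul, mul_sub, sub_mul]
  · simp [mul_add, add_mul, mul_sub, sub_mul]; noncomm_ring
  · simp [mul_add, add_mul, mul_sub, sub_mul]; noncomm_ring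
  · simp [mul_add, add_mul, mul_sub, sub_mul]; noncomm_ring

/-- [folklore] (β1⁰) … componentwise, for a PURE (`c00`) fluctuation letter `W = ι w`. -/
theorem conj_reversed_expand_ι (b c w : 𝔸) :
    (1 + τ₂ * ι c) * (1 + τ₁ * ι b) * ι w * ((1 - τ₁ * ι b) * (1 - τ₂ * ι c))
      = (Tau.mk w (b * w - w * b) (c * w - w * c) (c * (b * w - w * b) - (b * w - w * b) * c) : Tau 𝔸) := by
  rw [conj_reversed_expand]
  refine ext4 ?_ ?_ ?_ ?_ <;> simp [mul_sub, sub_mul]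

/-! ## §3 The `Rho` form: the flipped product chart as an ordered chart with rotated fluctuation and a commutator factor -/

/-- [folklore] (β3) **THE FLIPPED CHART IN ORDERED FORM**: in `Rho 𝔸`, `(1 + τ₂ιc)(1 + τ₁ιb)(1 + σW) = (1 + σW̃)·(1 + τ₁ιb)(1 + τ₂ιc)·(1 + τ₁τ₂ι[c,b])`
with `W̃ = W + τ₁[ιb,W] + τ₂[ιc,W] + τ₁τ₂[ιc,[ιb,W]]` (ANY `W : Tau 𝔸`, so Tau-valued fluctuation letters are covered). -/
theorem rho_reversed_chart (b c : 𝔸) (W : Tau 𝔸) :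
    (dmk (1 + τ₂ * ι c) 0 * dmk (1 + τ₁ * ι b) 0 * dmk 1 W : Rho 𝔸)
      = dmk 1 (W + τ₁ * (ι b * W - W * ι b) + τ₂ * (ι c * W - W * ι c) + τ12 * (ι c * (ι b * W - W * ι b) - (ι b * W - W * ι b) * ι c))
        * dmk ((1 + τ₁ * ι b) * (1 + τ₂ * ι c)) 0 * dmk (1 + τ12 * ι (c * b - b * c)) 0 := by
  rw [← conj_reversed_expand]
  refine TrivSqZeroExt.ext ?_ ?_
  · simp only [dfst_mul, fst_dmk, mul_one, one_mul]
    exact reversed_split b c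
  · simp only [dsnd_mul, dfst_mul, fst_dmk, snd_dmk, mul_one, one_mul, mul_zero, zero_mul, add_zero, zero_add]
    rw [mul_assoc ((1 + τ₂ * ι c) * (1 + τ₁ * ι b) * W * ((1 - τ₁ * ι b) * (1 - τ₂ * ι c))) ((1 + τ₁ * ι b) * (1 + τ₂ * ι c)),
      ← reversed_split, mul_assoc ((1 + τ₂ * ι c) * (1 + τ₁ * ι b) * W), inv_mul_reversed, mul_one]

/-- [folklore] (β3′) The same with the three right factors multiplied out: `… = dmk 1 W̃ * dmk ((1 + τ₂ιc)(1 + τ₁ιb)) 0`. -/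
theorem rho_reversed_chart' (b c : 𝔸) (W : Tau 𝔸) :
    (dmk (1 + τ₂ * ι c) 0 * dmk (1 + τ₁ * ι b) 0 * dmk 1 W : Rho 𝔸)
      = dmk 1 (W + τ₁ * (ι b * W - W * ι b) + τ₂ * (ι c * W - W * ι c) + τ12 * (ι c * (ι b * W - W * ι b) - (ι b * W - W * ι b) * ι c))
        * dmk ((1 + τ₂ * ι c) * (1 + τ₁ * ι b)) 0 := by
  rw [← conj_reversed_expand]
  refine TrivSqZeroExt.ext ?_ ?_
  · simp only [dfst_mul, fst_dmk, mul_one, one_mul]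
  · simp only [dsnd_mul, dfst_mul, fst_dmk, snd_dmk, mul_one, mul_zero, zero_mul, add_zero, zero_add]
    rw [mul_assoc ((1 + τ₂ * ι c) * (1 + τ₁ * ι b) * W), inv_mul_reversed, mul_one]

end Summit.QuantumFields.BalabanUV.Beta.ReversedChartCalculus
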